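/-
  HodgeLocusCensusUnitColumnRankLevelSymmetry.lean — pub-hlocus ENGINE B (ivhs-2, gen 56), PROBE 20.
  certified instances and evidence bearing on the general Hodge conjecture; no claim.

  KERNEL RANK THEOREMS (evidence class; no census number changes; nothing about HC). LEVEL SYMMETRY OF THE UNIT-COLUMN RANK.
  For a field K and anchor 229's multiplicity matrix M_K(j) of ×q^c on K[x₁,…,x_k]/(xᵢ^{e+2}) at level j (VERBATIM, as in anchors 230/294/296/298/304;
  rows = monomials of degree k(e+1) − j, columns = monomials of degree k(e+1) − j − c(e+1)):
  (SYM-F) `rank_levels_symm_field` — HEADLINE: for EVERY field K and all levels j + j′ = (k − c)(e + 1),  rank M_K(j) = rank M_K(j′):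
      the rank-versus-level profile is a palindrome. Route: anchor 294's block sum over the labels μ : Fin k → Fin (e+1) (c! a unit:
      `rank_levels_symm`; every prime p > c: `rank_levels_symm_of_lt`; p ≤ c: both ranks are 0 by anchor 230, `rank_levels_symm_charP`; ringChar K
      prime or 0: `rank_levels_symm_field`) is re-indexed by the label involution μ ↦ −μ of Fin (e+1) (0 ↦ 0, a ↦ e + 1 − a), which keeps the
      support s = #{μ ≠ 0} (`card_filter_neg_label`) and reflects Σμ (`sum_neg_label_add_sum`: Σ(−μ) + Σμ = (e+1)s), hence sends the block
      parameter t = (j + Σμ)/(e+1) − s of (j, μ) to m − t − c at (j′, −μ) (m = k − s) — and anchor 294's summand depends on t only through the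
      pair {t, m − t − c} (`summand_symm`: pure arithmetic, for an arbitrary G : ℕ → ℕ → ℕ in place of the two Wilson sums; `summand_neg_label_eq`:
      the summand VERBATIM).
  (SYM-drop) `rank_drop_symm`, (SYM-exc) `rank_lt_iff_symm` — for any two fields K, K₀ and j + j′ = (k − c)(e+1):
      rank_{K₀}(j) − rank_K(j) = rank_{K₀}(j′) − rank_K(j′) in ℤ and rank_K(j) < rank_{K₀}(j) ↔ rank_K(j′) < rank_{K₀}(j′): anchor 304's modular
      rank drop and its exceptional levels are symmetric about the centre (k − c)(e+1)/2 (304's (BDRY) level (e+1)(p − c) at k + c = 2p IS the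
      centre; the second-boundary band (e+1)(p − c) … (e+1)(p − c + 1) at k + c = 2p + 1 is centred there).
  M_K(j) is the matrix of ×(Σᵢ xᵢ^{e+1})^c between complementary degrees of the graded Gorenstein algebra K[x]/(xᵢ^{e+2}) (socle degree k(e+1)),
  so (SYM-F) is the rank shadow of its duality (a transpose pair) — obtained here from anchor 294's block formula alone, an independent
  consistency check of that formula. 10 theorems, 0 defs; imports anchor 294 `…HodgeLocusCensusUnitColumnRankLevelsWilson` by name (hence
  293, 230, 229); nothing restated but anchor 229's matrix and anchor 294's summand (VERBATIM); no sorries, axioms, instances or notation.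
-/
import Summits.HodgeConjecture.HodgeConjecture.Theorems.HodgeLocusCensusUnitColumnRankLevelsWilson

set_option linter.dupNamespace false
set_option autoImplicit false

namespace Summit.HodgeConjecture.HodgeConjecture.HodgeLocus.Census.UnitColumnRankLevelSymmetry

open Summit.HodgeConjecture.HodgeConjecture.HodgeLocus.Census.ModelNonJumpC1All (colR)
open Summit.HodgeConjecture.HodgeConjecture.HodgeLocus.Census.InclusionRankComplement (cast_factorial_ne_zero)
open Summit.HodgeConjecture.HodgeConjecture.HodgeLocus.Census.UnitColumnRankLevelsWilson (rank_mulDeltaPow_levels_eq_sum_wilson)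
open Summit.HodgeConjecture.HodgeConjecture.HodgeLocus.Census.UnitColumnRankLevelsChar (rank_mulDeltaPow_levels_eq_zero_of_charP)

/-! ## §1 the label involution `μ ↦ −μ` on `Fin k → Fin (e + 1)` (`0 ↦ 0`, `a ↦ e + 1 − a` for `1 ≤ a ≤ e`) -/

/-- (N1) `−μ` and `μ` have the same support, hence the same `s = #{l : μ l ≠ 0}`. -/
theorem card_filter_neg_label (k e : ℕ) (μ : Fin k → Fin (e + 1)) :
    (Finset.univ.filter (fun l => ((-μ) l : ℕ) ≠ 0)).card = (Finset.univ.filter (fun l => (μ l : ℕ) ≠ 0)).card := by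
  refine congrArg Finset.card (Finset.filter_congr (fun l _ => ?_))
  rw [Pi.neg_apply, ne_eq, ne_eq, Fin.val_eq_zero_iff, Fin.val_eq_zero_iff, neg_eq_zero]

/-- (N2) `Σ(−μ) + Σμ = (e + 1) · s`: every non-zero coordinate `a` is paired with `e + 1 − a`. -/
theorem sum_neg_label_add_sum (k e : ℕ) (μ : Fin k → Fin (e + 1)) :
    (∑ i, ((-μ) i : ℕ)) + ∑ i, (μ i : ℕ) = (e + 1) * (Finset.univ.filter (fun l => (μ l : ℕ) ≠ 0)).card := by
  rw [Finset.card_filter, Finset.mul_sum, ← Finset.sum_add_distrib]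
  refine Finset.sum_congr rfl (fun i _ => ?_)
  rw [Pi.neg_apply, Fin.val_neg']
  have hlt := (μ i).isLt
  by_cases h : (μ i : ℕ) = 0
  · rw [h, if_neg (fun hn => hn rfl), Nat.sub_zero, Nat.mod_self, mul_zero, Nat.add_zero]
  · rw [if_pos h, mul_one, Nat.mod_eq_of_lt (by omega)]
    omega

/-! ## §2 anchor 294's block summand is symmetric under `t ↦ m − t − c` -/

/-- (L1) THE BLOCK SYMMETRY, abstractly: for ANY `G : ℕ → ℕ → ℕ` (the two Wilson-sum branches of anchor 294 are `G (t + c) t` and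
`G (m − t) (m − t − c)`, `m = k − s`, `t = σ/(e+1) − s`) the summand attached to `σ = j + Σμ` equals the one attached to `σ'` whenever
`σ + σ' = (k − c)(e+1) + (e+1)s`: under `t' = m − t − c` feasibility with a non-empty block is preserved, `2t + c ≤ m ↔ m ≤ 2t' + c`, and
infeasible / empty-block labels pair with infeasible / empty-block labels. Pure arithmetic (`omega` after dividing by `e + 1`). -/
theorem summand_symm (G : ℕ → ℕ → ℕ) (k e c s σ σ' : ℕ) (hs : s ≤ k) (hσ : σ + σ' = (k - c) * (e + 1) + (e + 1) * s) :
    (if (e + 1) ∣ σ ∧ (e + 1) * s ≤ σ then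
        (if k - s < (σ / (e + 1) - s) + c then 0
         else if (σ / (e + 1) - s) + ((σ / (e + 1) - s) + c) ≤ k - s then G ((σ / (e + 1) - s) + c) (σ / (e + 1) - s)
         else G (k - s - (σ / (e + 1) - s)) (k - s - ((σ / (e + 1) - s) + c)))
     else 0) =
    (if (e + 1) ∣ σ' ∧ (e + 1) * s ≤ σ' then
        (if k - s < (σ' / (e + 1) - s) + c then 0
         else if (σ' / (e + 1) - s) + ((σ' / (e + 1) - s) + c) ≤ k - s then G ((σ' / (e + 1) - s) + c) (σ' / (e + 1) - s)
         else G (k - s - (σ' / (e + 1) - s)) (k - s - ((σ' / (e + 1) - s) + c)))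
     else 0) := by
  have hle : ∀ a b : ℕ, (e + 1) * a ≤ (e + 1) * b ↔ a ≤ b :=
    fun a b => ⟨fun h => Nat.le_of_mul_le_mul_left h (Nat.succ_pos e), fun h => Nat.mul_le_mul_left (e + 1) h⟩
  have key : ∀ a b a' b' : ℕ, a = a' → b = b' → G a b = G a' b' := fun a b a' b' h1 h2 => by rw [h1, h2]
  have hsum : (e + 1) ∣ σ + σ' := by rw [hσ]; exact dvd_add (Dvd.intro_left _ rfl) (Dvd.intro _ rfl)
  by_cases hd : (e + 1) ∣ σ
  · obtain ⟨q, rfl⟩ := hd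
    have hd' : (e + 1) ∣ σ' := by
      have h := Nat.dvd_sub hsum (Dvd.intro q rfl)
      rwa [Nat.add_sub_cancel_left] at h
    obtain ⟨q', rfl⟩ := hd'
    have hqq : q + q' = k - c + s := by
      rw [Nat.mul_comm (k - c) (e + 1), ← Nat.mul_add, ← Nat.mul_add] at hσ
      exact Nat.eq_of_mul_eq_mul_left (Nat.succ_pos e) hσ
    simp only [dvd_mul_right, true_and, Nat.mul_div_cancel_left q (Nat.succ_pos e), Nat.mul_div_cancel_left q' (Nat.succ_pos e), hle]
    split_ifs <;> first | rfl | exact key _ _ _ _ (by omega) (by omega) | omega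
  · have hd' : ¬ (e + 1) ∣ σ' := fun h => hd (by
      have h2 := Nat.dvd_sub hsum h
      rwa [Nat.add_sub_cancel] at h2)
    rw [if_neg (fun h => hd h.1), if_neg (fun h => hd' h.1)]

/-- (L3) hence anchor 294's summand (VERBATIM) of the label `μ` at level `j` equals that of `−μ` at level `j'`, `j + j' = (k − c)(e+1)`
((L1) with (N1), (N2)). -/
theorem summand_neg_label_eq (p k e c j j' : ℕ) (hjj : j + j' = (k - c) * (e + 1)) (μ : Fin k → Fin (e + 1)) :
    (if (e + 1) ∣ (j + ∑ i, (μ i : ℕ)) ∧ (e + 1) * (Finset.univ.filter (fun l => (μ l : ℕ) ≠ 0)).card ≤ j + ∑ i, (μ i : ℕ) then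
          (if k - (Finset.univ.filter (fun l => (μ l : ℕ) ≠ 0)).card <
              ((j + ∑ i, (μ i : ℕ)) / (e + 1) - (Finset.univ.filter (fun l => (μ l : ℕ) ≠ 0)).card) + c then 0
           else if ((j + ∑ i, (μ i : ℕ)) / (e + 1) - (Finset.univ.filter (fun l => (μ l : ℕ) ≠ 0)).card) +
              (((j + ∑ i, (μ i : ℕ)) / (e + 1) - (Finset.univ.filter (fun l => (μ l : ℕ) ≠ 0)).card) + c) ≤
              k - (Finset.univ.filter (fun l => (μ l : ℕ) ≠ 0)).card then
             ∑ i ∈ Finset.range (((j + ∑ i, (μ i : ℕ)) / (e + 1) - (Finset.univ.filter (fun l => (μ l : ℕ) ≠ 0)).card) + 1),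
               if p ∣ (((j + ∑ i, (μ i : ℕ)) / (e + 1) - (Finset.univ.filter (fun l => (μ l : ℕ) ≠ 0)).card) + c - i).choose
                   (((j + ∑ i, (μ i : ℕ)) / (e + 1) - (Finset.univ.filter (fun l => (μ l : ℕ) ≠ 0)).card) - i) then 0
               else ((k - (Finset.univ.filter (fun l => (μ l : ℕ) ≠ 0)).card).choose i -
                 if i = 0 then 0 else (k - (Finset.univ.filter (fun l => (μ l : ℕ) ≠ 0)).card).choose (i - 1))
           else
             ∑ i ∈ Finset.range (k - (Finset.univ.filter (fun l => (μ l : ℕ) ≠ 0)).card -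
                 (((j + ∑ i, (μ i : ℕ)) / (e + 1) - (Finset.univ.filter (fun l => (μ l : ℕ) ≠ 0)).card) + c) + 1),
               if p ∣ (k - (Finset.univ.filter (fun l => (μ l : ℕ) ≠ 0)).card -
                   ((j + ∑ i, (μ i : ℕ)) / (e + 1) - (Finset.univ.filter (fun l => (μ l : ℕ) ≠ 0)).card) - i).choose
                   (k - (Finset.univ.filter (fun l => (μ l : ℕ) ≠ 0)).card -
                     (((j + ∑ i, (μ i : ℕ)) / (e + 1) - (Finset.univ.filter (fun l => (μ l : ℕ) ≠ 0)).card) + c) - i) then 0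
               else ((k - (Finset.univ.filter (fun l => (μ l : ℕ) ≠ 0)).card).choose i -
                 if i = 0 then 0 else (k - (Finset.univ.filter (fun l => (μ l : ℕ) ≠ 0)).card).choose (i - 1)))
         else 0) =
    (if (e + 1) ∣ (j' + ∑ i, ((-μ) i : ℕ)) ∧ (e + 1) * (Finset.univ.filter (fun l => ((-μ) l : ℕ) ≠ 0)).card ≤ j' + ∑ i, ((-μ) i : ℕ) then
          (if k - (Finset.univ.filter (fun l => ((-μ) l : ℕ) ≠ 0)).card <
              ((j' + ∑ i, ((-μ) i : ℕ)) / (e + 1) - (Finset.univ.filter (fun l => ((-μ) l : ℕ) ≠ 0)).card) + c then 0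
           else if ((j' + ∑ i, ((-μ) i : ℕ)) / (e + 1) - (Finset.univ.filter (fun l => ((-μ) l : ℕ) ≠ 0)).card) +
              (((j' + ∑ i, ((-μ) i : ℕ)) / (e + 1) - (Finset.univ.filter (fun l => ((-μ) l : ℕ) ≠ 0)).card) + c) ≤
              k - (Finset.univ.filter (fun l => ((-μ) l : ℕ) ≠ 0)).card then
             ∑ i ∈ Finset.range (((j' + ∑ i, ((-μ) i : ℕ)) / (e + 1) - (Finset.univ.filter (fun l => ((-μ) l : ℕ) ≠ 0)).card) + 1),
               if p ∣ (((j' + ∑ i, ((-μ) i : ℕ)) / (e + 1) - (Finset.univ.filter (fun l => ((-μ) l : ℕ) ≠ 0)).card) + c - i).choose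
                   (((j' + ∑ i, ((-μ) i : ℕ)) / (e + 1) - (Finset.univ.filter (fun l => ((-μ) l : ℕ) ≠ 0)).card) - i) then 0
               else ((k - (Finset.univ.filter (fun l => ((-μ) l : ℕ) ≠ 0)).card).choose i -
                 if i = 0 then 0 else (k - (Finset.univ.filter (fun l => ((-μ) l : ℕ) ≠ 0)).card).choose (i - 1))
           else
             ∑ i ∈ Finset.range (k - (Finset.univ.filter (fun l => ((-μ) l : ℕ) ≠ 0)).card -
                 (((j' + ∑ i, ((-μ) i : ℕ)) / (e + 1) - (Finset.univ.filter (fun l => ((-μ) l : ℕ) ≠ 0)).card) + c) + 1),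
               if p ∣ (k - (Finset.univ.filter (fun l => ((-μ) l : ℕ) ≠ 0)).card -
                   ((j' + ∑ i, ((-μ) i : ℕ)) / (e + 1) - (Finset.univ.filter (fun l => ((-μ) l : ℕ) ≠ 0)).card) - i).choose
                   (k - (Finset.univ.filter (fun l => ((-μ) l : ℕ) ≠ 0)).card -
                     (((j' + ∑ i, ((-μ) i : ℕ)) / (e + 1) - (Finset.univ.filter (fun l => ((-μ) l : ℕ) ≠ 0)).card) + c) - i) then 0
               else ((k - (Finset.univ.filter (fun l => ((-μ) l : ℕ) ≠ 0)).card).choose i -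
                 if i = 0 then 0 else (k - (Finset.univ.filter (fun l => ((-μ) l : ℕ) ≠ 0)).card).choose (i - 1)))
         else 0) := by
  rw [card_filter_neg_label k e μ]
  exact summand_symm (fun a b => ∑ i ∈ Finset.range (b + 1),
      if p ∣ (a - i).choose (b - i) then 0
      else ((k - (Finset.univ.filter (fun l => (μ l : ℕ) ≠ 0)).card).choose i -
        if i = 0 then 0 else (k - (Finset.univ.filter (fun l => (μ l : ℕ) ≠ 0)).card).choose (i - 1))) k e c _ _ _
    ((Finset.card_filter_le _ _).trans_eq (by rw [Finset.card_univ, Fintype.card_fin]))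
    (by have h := sum_neg_label_add_sum k e μ; omega)

/-! ## §3 LEVEL SYMMETRY of the rank of anchor 229's multiplicity matrix -/

/-- **(SYM) LEVEL SYMMETRY.** For every field `K` in which `c!` is a unit (every characteristic `0` or `p > c`) and all levels
`j + j' = (k − c)(e + 1)`, anchor 229's multiplicity matrix of `×q^c` on `K[x₁,…,x_k]/(xᵢ^{e+2})` (VERBATIM) has the SAME rank at
level `j` and at level `j'`: anchor 294's block sum re-indexed by `μ ↦ −μ` ((L3), `Fintype.sum_equiv`). This is the numerical shadow of
the duality of the graded Gorenstein algebra `K[x]/(xᵢ^{e+2})` (`×q^c : A_a → A_{a+d}` is the transpose of `×q^c : A_{top−a−d} → A_{top−a}`),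
obtained here without any duality, from the block formula alone. -/
theorem rank_levels_symm (K : Type*) [Field K] (p : ℕ) [CharP K p] (k e c j j' : ℕ) (hc : ((c.factorial : ℕ) : K) ≠ 0)
    (hjj : j + j' = (k - c) * (e + 1)) :
    (Matrix.of fun (v : {v : Fin k → Fin (e + 2) // (∑ i, (v i : ℕ)) + j = k * (e + 1)})
        (m : {m : Fin k → Fin (e + 2) // (∑ i, (m i : ℕ)) + (j + c * (e + 1)) = k * (e + 1)}) =>
      ((((List.flatMap (colR (e + 3)))^[c] [List.ofFn (fun i => (m.1 i : ℕ))]).count (List.ofFn (fun i => (v.1 i : ℕ))) : ℕ) : K)).rank =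
    (Matrix.of fun (v : {v : Fin k → Fin (e + 2) // (∑ i, (v i : ℕ)) + j' = k * (e + 1)})
        (m : {m : Fin k → Fin (e + 2) // (∑ i, (m i : ℕ)) + (j' + c * (e + 1)) = k * (e + 1)}) =>
      ((((List.flatMap (colR (e + 3)))^[c] [List.ofFn (fun i => (m.1 i : ℕ))]).count (List.ofFn (fun i => (v.1 i : ℕ))) : ℕ) : K)).rank := by
  rw [rank_mulDeltaPow_levels_eq_sum_wilson K p k e c j hc, rank_mulDeltaPow_levels_eq_sum_wilson K p k e c j' hc]
  exact Fintype.sum_equiv (Equiv.neg _) _ _ (fun μ => summand_neg_label_eq p k e c j j' hjj μ)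

/-- (SYM-p) level symmetry in every prime characteristic `p > c` (anchor 293's `cast_factorial_ne_zero`). -/
theorem rank_levels_symm_of_lt (K : Type*) [Field K] (p : ℕ) [CharP K p] (hp : p.Prime) (k e c j j' : ℕ) (hcp : c < p)
    (hjj : j + j' = (k - c) * (e + 1)) :
    (Matrix.of fun (v : {v : Fin k → Fin (e + 2) // (∑ i, (v i : ℕ)) + j = k * (e + 1)})
        (m : {m : Fin k → Fin (e + 2) // (∑ i, (m i : ℕ)) + (j + c * (e + 1)) = k * (e + 1)}) =>
      ((((List.flatMap (colR (e + 3)))^[c] [List.ofFn (fun i => (m.1 i : ℕ))]).count (List.ofFn (fun i => (v.1 i : ℕ))) : ℕ) : K)).rank =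
    (Matrix.of fun (v : {v : Fin k → Fin (e + 2) // (∑ i, (v i : ℕ)) + j' = k * (e + 1)})
        (m : {m : Fin k → Fin (e + 2) // (∑ i, (m i : ℕ)) + (j' + c * (e + 1)) = k * (e + 1)}) =>
      ((((List.flatMap (colR (e + 3)))^[c] [List.ofFn (fun i => (m.1 i : ℕ))]).count (List.ofFn (fun i => (v.1 i : ℕ))) : ℕ) : K)).rank :=
  rank_levels_symm K p k e c j j' (cast_factorial_ne_zero K p hp c hcp) hjj

/-- (SYM-P) level symmetry in EVERY prime characteristic: for `p ≤ c` both ranks vanish (anchor 230's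
`rank_mulDeltaPow_levels_eq_zero_of_charP`, `p ∣ c!`). -/
theorem rank_levels_symm_charP (K : Type*) [Field K] (p : ℕ) [CharP K p] (hp : p.Prime) (k e c j j' : ℕ)
    (hjj : j + j' = (k - c) * (e + 1)) :
    (Matrix.of fun (v : {v : Fin k → Fin (e + 2) // (∑ i, (v i : ℕ)) + j = k * (e + 1)})
        (m : {m : Fin k → Fin (e + 2) // (∑ i, (m i : ℕ)) + (j + c * (e + 1)) = k * (e + 1)}) =>
      ((((List.flatMap (colR (e + 3)))^[c] [List.ofFn (fun i => (m.1 i : ℕ))]).count (List.ofFn (fun i => (v.1 i : ℕ))) : ℕ) : K)).rank =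
    (Matrix.of fun (v : {v : Fin k → Fin (e + 2) // (∑ i, (v i : ℕ)) + j' = k * (e + 1)})
        (m : {m : Fin k → Fin (e + 2) // (∑ i, (m i : ℕ)) + (j' + c * (e + 1)) = k * (e + 1)}) =>
      ((((List.flatMap (colR (e + 3)))^[c] [List.ofFn (fun i => (m.1 i : ℕ))]).count (List.ofFn (fun i => (v.1 i : ℕ))) : ℕ) : K)).rank := by
  rcases Nat.lt_or_ge c p with hcp | hpc
  · exact rank_levels_symm_of_lt K p hp k e c j j' hcp hjj
  · rw [rank_mulDeltaPow_levels_eq_zero_of_charP K p hp k e c j hpc, rank_mulDeltaPow_levels_eq_zero_of_charP K p hp k e c j' hpc]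

/-- **(SYM-F) LEVEL SYMMETRY OVER EVERY FIELD**, with no hypothesis on the characteristic (`ringChar K` is a prime — (SYM-P) — or `0`,
where `c!` is a unit — (SYM)); in particular in characteristic `0` (THEOREM L's rank, anchor 229). -/
theorem rank_levels_symm_field (K : Type*) [Field K] (k e c j j' : ℕ) (hjj : j + j' = (k - c) * (e + 1)) :
    (Matrix.of fun (v : {v : Fin k → Fin (e + 2) // (∑ i, (v i : ℕ)) + j = k * (e + 1)})
        (m : {m : Fin k → Fin (e + 2) // (∑ i, (m i : ℕ)) + (j + c * (e + 1)) = k * (e + 1)}) =>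
      ((((List.flatMap (colR (e + 3)))^[c] [List.ofFn (fun i => (m.1 i : ℕ))]).count (List.ofFn (fun i => (v.1 i : ℕ))) : ℕ) : K)).rank =
    (Matrix.of fun (v : {v : Fin k → Fin (e + 2) // (∑ i, (v i : ℕ)) + j' = k * (e + 1)})
        (m : {m : Fin k → Fin (e + 2) // (∑ i, (m i : ℕ)) + (j' + c * (e + 1)) = k * (e + 1)}) =>
      ((((List.flatMap (colR (e + 3)))^[c] [List.ofFn (fun i => (m.1 i : ℕ))]).count (List.ofFn (fun i => (v.1 i : ℕ))) : ℕ) : K)).rank := by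
  rcases CharP.char_is_prime_or_zero K (ringChar K) with hp | hp
  · exact rank_levels_symm_charP K (ringChar K) hp k e c j j' hjj
  · have h0 : CharP K 0 := ringChar.of_eq hp
    exact rank_levels_symm K 0 k e c j j'
      (fun h => Nat.factorial_ne_zero c (zero_dvd_iff.mp ((CharP.cast_eq_zero_iff K 0 _).mp h))) hjj

/-- (SYM-drop) hence THE MODULAR RANK DROP IS SYMMETRIC IN THE LEVEL: for ANY two fields `K`, `K₀` (of record: `char K = p > c`,
`char K₀ = 0`, when it is anchor 304's drop) and `j + j' = (k − c)(e+1)`: `rank_{K₀}(j) − rank_K(j) = rank_{K₀}(j') − rank_K(j')` in `ℤ`. -/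
theorem rank_drop_symm (K K₀ : Type*) [Field K] [Field K₀] (k e c j j' : ℕ) (hjj : j + j' = (k - c) * (e + 1)) :
    (((Matrix.of fun (v : {v : Fin k → Fin (e + 2) // (∑ i, (v i : ℕ)) + j = k * (e + 1)})
        (m : {m : Fin k → Fin (e + 2) // (∑ i, (m i : ℕ)) + (j + c * (e + 1)) = k * (e + 1)}) =>
      ((((List.flatMap (colR (e + 3)))^[c] [List.ofFn (fun i => (m.1 i : ℕ))]).count (List.ofFn (fun i => (v.1 i : ℕ))) : ℕ) : K₀)).rank : ℕ) : ℤ) -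
      (((Matrix.of fun (v : {v : Fin k → Fin (e + 2) // (∑ i, (v i : ℕ)) + j = k * (e + 1)})
        (m : {m : Fin k → Fin (e + 2) // (∑ i, (m i : ℕ)) + (j + c * (e + 1)) = k * (e + 1)}) =>
      ((((List.flatMap (colR (e + 3)))^[c] [List.ofFn (fun i => (m.1 i : ℕ))]).count (List.ofFn (fun i => (v.1 i : ℕ))) : ℕ) : K)).rank : ℕ) : ℤ) =
    (((Matrix.of fun (v : {v : Fin k → Fin (e + 2) // (∑ i, (v i : ℕ)) + j' = k * (e + 1)})
        (m : {m : Fin k → Fin (e + 2) // (∑ i, (m i : ℕ)) + (j' + c * (e + 1)) = k * (e + 1)}) =>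
      ((((List.flatMap (colR (e + 3)))^[c] [List.ofFn (fun i => (m.1 i : ℕ))]).count (List.ofFn (fun i => (v.1 i : ℕ))) : ℕ) : K₀)).rank : ℕ) : ℤ) -
      (((Matrix.of fun (v : {v : Fin k → Fin (e + 2) // (∑ i, (v i : ℕ)) + j' = k * (e + 1)})
        (m : {m : Fin k → Fin (e + 2) // (∑ i, (m i : ℕ)) + (j' + c * (e + 1)) = k * (e + 1)}) =>
      ((((List.flatMap (colR (e + 3)))^[c] [List.ofFn (fun i => (m.1 i : ℕ))]).count (List.ofFn (fun i => (v.1 i : ℕ))) : ℕ) : K)).rank : ℕ) : ℤ) := by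
  rw [rank_levels_symm_field K k e c j j' hjj, rank_levels_symm_field K₀ k e c j j' hjj]

/-- (SYM-exc) and THE EXCEPTIONAL LEVELS COME IN SYMMETRIC PAIRS: `rank_K(j) < rank_{K₀}(j) ↔ rank_K(j') < rank_{K₀}(j')` for ANY two
fields and `j + j' = (k − c)(e+1)` — consistent with anchor 304's (BDRY) (`k + c = 2p`: the single exceptional level `(e+1)(p − c)` IS the
centre `(k − c)(e+1)/2`) and pairing the first exceptional level of anchors 278/296 with a last one. -/
theorem rank_lt_iff_symm (K K₀ : Type*) [Field K] [Field K₀] (k e c j j' : ℕ) (hjj : j + j' = (k - c) * (e + 1)) :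
    (Matrix.of fun (v : {v : Fin k → Fin (e + 2) // (∑ i, (v i : ℕ)) + j = k * (e + 1)})
        (m : {m : Fin k → Fin (e + 2) // (∑ i, (m i : ℕ)) + (j + c * (e + 1)) = k * (e + 1)}) =>
      ((((List.flatMap (colR (e + 3)))^[c] [List.ofFn (fun i => (m.1 i : ℕ))]).count (List.ofFn (fun i => (v.1 i : ℕ))) : ℕ) : K)).rank <
    (Matrix.of fun (v : {v : Fin k → Fin (e + 2) // (∑ i, (v i : ℕ)) + j = k * (e + 1)})
        (m : {m : Fin k → Fin (e + 2) // (∑ i, (m i : ℕ)) + (j + c * (e + 1)) = k * (e + 1)}) =>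
      ((((List.flatMap (colR (e + 3)))^[c] [List.ofFn (fun i => (m.1 i : ℕ))]).count (List.ofFn (fun i => (v.1 i : ℕ))) : ℕ) : K₀)).rank ↔
    (Matrix.of fun (v : {v : Fin k → Fin (e + 2) // (∑ i, (v i : ℕ)) + j' = k * (e + 1)})
        (m : {m : Fin k → Fin (e + 2) // (∑ i, (m i : ℕ)) + (j' + c * (e + 1)) = k * (e + 1)}) =>
      ((((List.flatMap (colR (e + 3)))^[c] [List.ofFn (fun i => (m.1 i : ℕ))]).count (List.ofFn (fun i => (v.1 i : ℕ))) : ℕ) : K)).rank <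
    (Matrix.of fun (v : {v : Fin k → Fin (e + 2) // (∑ i, (v i : ℕ)) + j' = k * (e + 1)})
        (m : {m : Fin k → Fin (e + 2) // (∑ i, (m i : ℕ)) + (j' + c * (e + 1)) = k * (e + 1)}) =>
      ((((List.flatMap (colR (e + 3)))^[c] [List.ofFn (fun i => (m.1 i : ℕ))]).count (List.ofFn (fun i => (v.1 i : ℕ))) : ℕ) : K₀)).rank := by
  rw [rank_levels_symm_field K k e c j j' hjj, rank_levels_symm_field K₀ k e c j j' hjj]

end Summit.HodgeConjecture.HodgeConjecture.HodgeLocus.Census.UnitColumnRankLevelSymmetry
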